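import Summits.AtomisticToContinuum.FouriersLaw.Theses.OddSectorIrreversibility
import Literature.Barriers.AtomisticToContinuum.LowTemperatureWeakAnharmonicity

/-!
# `BoundedResponseConverges` / Negative: scale covariance — the crux is its own `T = 1` slice

Structural record for crux `stmt-AtomisticToContinuum-9141`
(`OddSectorIrreversibility.BoundedResponseConverges`), crux disprover, cycle 1 (2026-08-16).
By the PROVED amplitude-scaling conjugacy of the Langevin-driven pinned chain
(`Literature.Barriers.AtomisticToContinuum.LowTemperatureWeakAnharmonicity`: `isSteadyState_map_smul`,
`isSteadyState_map_inv_smul`, `totalCurrent_map_smul`, `map_smul_map_inv_smul`; Aoki–Lukkarinen–Spohn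
2006 §2 (2.8)–(2.13)) the push-forward `(q,p) ↦ (s q, s p)` maps steady states of the
`(lam s², β s²)` chain at `(T_L, T_R)` to steady states of the `(lam, β)` chain at `(s²T_L, s²T_R)`,
multiplies currents by `s²`, and therefore leaves the response sequence `D_N` INVARIANT
(`δ ↦ δ/s²`). Consequences recorded here (all about the typed matrix of the crux; nothing closes an
item):

* `boundedResponseConverges_unique_of_smul` — weak-NESS uniqueness transports along the scaling;
* `boundedResponseConverges_slice_of_smul` — the `T`-slice of the crux's matrix for `(lam, β)` at
  temperature `s² T` implies the slice for `(lam s², β s²)` at temperature `T`;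
* `boundedResponseConverges_slice_iff_unit_temperature` — the slice at `(lam, β, T)` is the slice at
  `(lam T, β T, 1)`: LOW TEMPERATURE IS WEAK ANHARMONICITY;
* `boundedResponseConverges_iff_unit_temperature` — the crux is EQUIVALENT to its restriction to
  `T = 1`. For provers: WLOG `T = 1`. For would-be strengthenings: the low-temperature end of the crux
  is the ray `(lam T, β T) → (0,0)` towards the harmonic corner, where the matrix holds only vacuously
  (ballistic response, `LoadBearing.lean`), so no `T`-uniform version of the crux can be true and
  every proof must degenerate as `T → 0`.
-/

noncomputable section

namespace Summit.AtomisticToContinuum.FouriersLaw.Theorems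

open MeasureTheory Filter Topology
open Literature.MathematicalPhysics.KineticTheory.HeatConduction
open Literature.Barriers.AtomisticToContinuum.HeatConduction
open Summit.AtomisticToContinuum.FouriersLaw.Theses.OddSectorIrreversibility (BoundedResponseConverges)

/-- Weak-NESS uniqueness for the `(lam s², β s²)` chain gives it for the `(lam, β)` chain (`s ≠ 0`):
push two steady states forward by `x ↦ s⁻¹ • x`, identify, pull back. [cite: AokiLukkarinenSpohn2006, §2 eqs. (2.8)-(2.13)] -/
theorem boundedResponseConverges_unique_of_smul (ω₂ lam β γ : ℝ) {s : ℝ} (hs : s ≠ 0)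
    (hu' : (∀ (N : ℕ) (T_L T_R : ℝ), 0 < T_L → 0 < T_R → ∀ μ ν : Measure (PhaseSpace N),
        (pinnedChain ω₂ (lam * s ^ 2) (β * s ^ 2) γ).IsSteadyState N T_L T_R μ → (pinnedChain ω₂ (lam * s ^ 2) (β * s ^ 2) γ).IsSteadyState N T_L T_R ν → μ = ν)) :
    (∀ (N : ℕ) (T_L T_R : ℝ), 0 < T_L → 0 < T_R → ∀ μ ν : Measure (PhaseSpace N),
        (pinnedChain ω₂ lam β γ).IsSteadyState N T_L T_R μ → (pinnedChain ω₂ lam β γ).IsSteadyState N T_L T_R ν → μ = ν) := by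
  intro N T_L T_R hL hR μ ν hμ hν
  have hs2 : (0 : ℝ) < s⁻¹ ^ 2 := by positivity
  have hμ' := isSteadyState_map_inv_smul ω₂ lam β γ hs hμ
  have hν' := isSteadyState_map_inv_smul ω₂ lam β γ hs hν
  have heq := hu' N _ _ (mul_pos hs2 hL) (mul_pos hs2 hR) _ _ hμ' hν'
  calc μ = (μ.map fun x => s⁻¹ • x).map (fun x => s • x) := (map_smul_map_inv_smul hs μ).symm
    _ = (ν.map fun x => s⁻¹ • x).map (fun x => s • x) := by rw [heq]
    _ = ν := map_smul_map_inv_smul hs ν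

/-- **Scale covariance of the crux's `T`-slice (one direction).** The matrix of the crux for the
`(lam, β)` chain at temperature `s² T` implies the matrix for the `(lam s², β s²)` chain at
temperature `T`: families and uniqueness are transported by `(q,p) ↦ (s q, s p)`, response quotients
by `δ ↦ δ/s²`, and the response sequence `D` is unchanged. [cite: AokiLukkarinenSpohn2006, §2 eqs. (2.11)-(2.13)] -/
theorem boundedResponseConverges_slice_of_smul (ω₂ lam β γ : ℝ) {s : ℝ} (hs : s ≠ 0) {T : ℝ}
    (h : (∀ (N : ℕ) (T_L T_R : ℝ), 0 < T_L → 0 < T_R → ∀ μ ν : Measure (PhaseSpace N),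
        (pinnedChain ω₂ lam β γ).IsSteadyState N T_L T_R μ → (pinnedChain ω₂ lam β γ).IsSteadyState N T_L T_R ν → μ = ν) →
      ∀ μ : (N : ℕ) → ℝ → ℝ → Measure (PhaseSpace N),
        (∀ (N : ℕ) (T_L T_R : ℝ), 0 < T_L → 0 < T_R → (pinnedChain ω₂ lam β γ).IsSteadyState N T_L T_R (μ N T_L T_R)) →
        ∀ D : ℕ → ℝ,
          (∀ N : ℕ, Tendsto (fun δ : ℝ => (pinnedChain ω₂ lam β γ).totalCurrent (μ N (s ^ 2 * T + δ / 2) (s ^ 2 * T - δ / 2)) / δ)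
            (𝓝[≠] 0) (𝓝 (D N))) →
          BddAbove (Set.range fun N => |D N|) → ∃ k : ℝ, 0 < k ∧ Tendsto D atTop (𝓝 k)) :
    (∀ (N : ℕ) (T_L T_R : ℝ), 0 < T_L → 0 < T_R → ∀ μ ν : Measure (PhaseSpace N),
        (pinnedChain ω₂ (lam * s ^ 2) (β * s ^ 2) γ).IsSteadyState N T_L T_R μ → (pinnedChain ω₂ (lam * s ^ 2) (β * s ^ 2) γ).IsSteadyState N T_L T_R ν → μ = ν) →
    ∀ μ : (N : ℕ) → ℝ → ℝ → Measure (PhaseSpace N),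
      (∀ (N : ℕ) (T_L T_R : ℝ), 0 < T_L → 0 < T_R → (pinnedChain ω₂ (lam * s ^ 2) (β * s ^ 2) γ).IsSteadyState N T_L T_R (μ N T_L T_R)) →
      ∀ D : ℕ → ℝ,
        (∀ N : ℕ, Tendsto (fun δ : ℝ => (pinnedChain ω₂ (lam * s ^ 2) (β * s ^ 2) γ).totalCurrent (μ N (T + δ / 2) (T - δ / 2)) / δ)
          (𝓝[≠] 0) (𝓝 (D N))) →
        BddAbove (Set.range fun N => |D N|) → ∃ k : ℝ, 0 < k ∧ Tendsto D atTop (𝓝 k) := by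
  set P := pinnedChain ω₂ lam β γ with hP
  set P' := pinnedChain ω₂ (lam * s ^ 2) (β * s ^ 2) γ with hP'
  have hs2 : (0 : ℝ) < s ^ 2 := by positivity
  intro hu' μ' hμ' D hD' hB
  have hu := boundedResponseConverges_unique_of_smul ω₂ lam β γ hs hu'
  set μ : (N : ℕ) → ℝ → ℝ → Measure (PhaseSpace N) := fun N a b =>
    (μ' N (a / s ^ 2) (b / s ^ 2)).map fun x => s • x with hμdef
  have hμ : ∀ (N : ℕ) (a b : ℝ), 0 < a → 0 < b → P.IsSteadyState N a b (μ N a b) := by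
    intro N a b ha hb
    have := isSteadyState_map_smul ω₂ lam β γ hs
      (hμ' N (a / s ^ 2) (b / s ^ 2) (div_pos ha hs2) (div_pos hb hs2))
    have e1 : s ^ 2 * (a / s ^ 2) = a := by field_simp
    have e2 : s ^ 2 * (b / s ^ 2) = b := by field_simp
    rw [e1, e2] at this
    exact this
  have hD : ∀ N : ℕ, Tendsto (fun δ : ℝ =>
      P.totalCurrent (μ N (s ^ 2 * T + δ / 2) (s ^ 2 * T - δ / 2)) / δ) (𝓝[≠] 0) (𝓝 (D N)) := by
    intro N
    have hid : ∀ δ : ℝ, P.totalCurrent (μ N (s ^ 2 * T + δ / 2) (s ^ 2 * T - δ / 2)) / δ =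
        P'.totalCurrent (μ' N (T + δ / s ^ 2 / 2) (T - δ / s ^ 2 / 2)) / (δ / s ^ 2) := by
      intro δ
      have ha : (s ^ 2 * T + δ / 2) / s ^ 2 = T + δ / s ^ 2 / 2 := by field_simp
      have hb : (s ^ 2 * T - δ / 2) / s ^ 2 = T - δ / s ^ 2 / 2 := by field_simp
      rw [hμdef]
      dsimp only
      rw [ha, hb, totalCurrent_map_smul ω₂ lam β γ hs, ← hP']
      field_simp
    have hcomp : Tendsto (fun δ : ℝ => δ / s ^ 2) (𝓝[≠] 0) (𝓝[≠] 0) := by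
      refine tendsto_nhdsWithin_of_tendsto_nhds_of_eventually_within _ ?_ ?_
      · have : Tendsto (fun δ : ℝ => δ / s ^ 2) (𝓝 0) (𝓝 (0 / s ^ 2)) :=
          tendsto_id.div_const _
        rw [zero_div] at this
        exact this.mono_left nhdsWithin_le_nhds
      · filter_upwards [self_mem_nhdsWithin] with δ hδ
        exact div_ne_zero hδ hs2.ne'
    refine ((hD' N).comp hcomp).congr fun δ => ?_
    rw [Function.comp_apply, hid δ]
  exact h hu μ hμ D hD hB

/-- **Low temperature is weak anharmonicity**: the crux's slice at `(lam, β, T)` (`T > 0`) is its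
slice at `(lam T, β T, 1)`. [cite: AokiLukkarinenSpohn2006, §2 eq. (2.13)] -/
theorem boundedResponseConverges_slice_iff_unit_temperature (ω₂ lam β γ : ℝ) {T : ℝ} (hT : 0 < T) :
    ((∀ (N : ℕ) (T_L T_R : ℝ), 0 < T_L → 0 < T_R → ∀ μ ν : Measure (PhaseSpace N),
        (pinnedChain ω₂ lam β γ).IsSteadyState N T_L T_R μ → (pinnedChain ω₂ lam β γ).IsSteadyState N T_L T_R ν → μ = ν) →
      ∀ μ : (N : ℕ) → ℝ → ℝ → Measure (PhaseSpace N),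
        (∀ (N : ℕ) (T_L T_R : ℝ), 0 < T_L → 0 < T_R → (pinnedChain ω₂ lam β γ).IsSteadyState N T_L T_R (μ N T_L T_R)) →
        ∀ D : ℕ → ℝ,
          (∀ N : ℕ, Tendsto (fun δ : ℝ => (pinnedChain ω₂ lam β γ).totalCurrent (μ N (T + δ / 2) (T - δ / 2)) / δ)
            (𝓝[≠] 0) (𝓝 (D N))) →
          BddAbove (Set.range fun N => |D N|) → ∃ k : ℝ, 0 < k ∧ Tendsto D atTop (𝓝 k)) ↔
    ((∀ (N : ℕ) (T_L T_R : ℝ), 0 < T_L → 0 < T_R → ∀ μ ν : Measure (PhaseSpace N),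
        (pinnedChain ω₂ (lam * T) (β * T) γ).IsSteadyState N T_L T_R μ → (pinnedChain ω₂ (lam * T) (β * T) γ).IsSteadyState N T_L T_R ν → μ = ν) →
    ∀ μ : (N : ℕ) → ℝ → ℝ → Measure (PhaseSpace N),
      (∀ (N : ℕ) (T_L T_R : ℝ), 0 < T_L → 0 < T_R → (pinnedChain ω₂ (lam * T) (β * T) γ).IsSteadyState N T_L T_R (μ N T_L T_R)) →
      ∀ D : ℕ → ℝ,
        (∀ N : ℕ, Tendsto (fun δ : ℝ => (pinnedChain ω₂ (lam * T) (β * T) γ).totalCurrent (μ N (1 + δ / 2) (1 - δ / 2)) / δ)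
          (𝓝[≠] 0) (𝓝 (D N))) →
        BddAbove (Set.range fun N => |D N|) → ∃ k : ℝ, 0 < k ∧ Tendsto D atTop (𝓝 k)) := by
  have hs : Real.sqrt T ≠ 0 := (Real.sqrt_pos.2 hT).ne'
  have hsq : Real.sqrt T ^ 2 = T := Real.sq_sqrt hT.le
  constructor
  · intro h
    have key := @boundedResponseConverges_slice_of_smul ω₂ lam β γ (Real.sqrt T) hs 1
    rw [hsq, mul_one] at key
    exact key h
  · intro h
    have hs' : (Real.sqrt T)⁻¹ ≠ 0 := inv_ne_zero hs
    have key := @boundedResponseConverges_slice_of_smul ω₂ (lam * T) (β * T) γ (Real.sqrt T)⁻¹ hs' T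
    have e1 : lam * T * (Real.sqrt T)⁻¹ ^ 2 = lam := by rw [inv_pow, hsq]; field_simp
    have e2 : β * T * (Real.sqrt T)⁻¹ ^ 2 = β := by rw [inv_pow, hsq]; field_simp
    have e3 : (Real.sqrt T)⁻¹ ^ 2 * T = 1 := by rw [inv_pow, hsq]; field_simp
    rw [e1, e2, e3] at key
    exact key h

/-- **The crux is its own `T = 1` slice.** `BoundedResponseConverges` ↔ its restriction to
temperature `1` over all `ω₂, lam, β, γ > 0`. [folklore] -/
theorem boundedResponseConverges_iff_unit_temperature :
    BoundedResponseConverges ↔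
      ∀ ω₂ lam β γ : ℝ, 0 < ω₂ → 0 < lam → 0 < β → 0 < γ →
      (∀ (N : ℕ) (T_L T_R : ℝ), 0 < T_L → 0 < T_R → ∀ μ ν : Measure (PhaseSpace N),
        (pinnedChain ω₂ lam β γ).IsSteadyState N T_L T_R μ → (pinnedChain ω₂ lam β γ).IsSteadyState N T_L T_R ν → μ = ν) →
      ∀ μ : (N : ℕ) → ℝ → ℝ → Measure (PhaseSpace N),
        (∀ (N : ℕ) (T_L T_R : ℝ), 0 < T_L → 0 < T_R → (pinnedChain ω₂ lam β γ).IsSteadyState N T_L T_R (μ N T_L T_R)) →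
        ∀ D : ℕ → ℝ,
          (∀ N : ℕ, Tendsto (fun δ : ℝ => (pinnedChain ω₂ lam β γ).totalCurrent (μ N (1 + δ / 2) (1 - δ / 2)) / δ)
            (𝓝[≠] 0) (𝓝 (D N))) →
          BddAbove (Set.range fun N => |D N|) → ∃ k : ℝ, 0 < k ∧ Tendsto D atTop (𝓝 k) := by
  constructor
  · intro h ω₂ lam β γ hω hl hβ hγ hu μ hμ D hD hB
    exact h ω₂ lam β γ hω hl hβ hγ hu μ hμ 1 one_pos D hD hB
  · intro h ω₂ lam β γ hω hl hβ hγ hu μ hμ T hT D hD hB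
    have key := (boundedResponseConverges_slice_iff_unit_temperature ω₂ lam β γ hT).2
      (h ω₂ (lam * T) (β * T) γ hω (mul_pos hl hT) (mul_pos hβ hT) hγ)
    exact key hu μ hμ D hD hB

end Summit.AtomisticToContinuum.FouriersLaw.Theorems

end
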